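import Literature.NumberTheory.Automorphic.BaseChangeStrongAllFiniteRankOne
import Literature.NumberTheory.GaloisRepresentations.GlobalArtinMapNormProofs
import HarnessLib

/-!
# `(ω ∘ N_{E/F})(ϖ_w) = ω(ϖ_v)^{f(w|v)}` at EVERY finite place `w ∣ v` (ramified or not)

Topic `NumberTheory/GaloisRepresentations` (namespace `Literature.NumberTheory.GaloisRepresentations.HeckeCharacter`).
PROOFS ONLY (no definition, no named fact, no `sorry`). The tree's
`HeckeCharacter.compRelNorm_valueAtUniformizer` (`GlobalArtinMapNormProofs`) computes the value of the base
change `ω.compRelNorm E = ω ∘ N_{E/F}` at a uniformizer of `w ∣ v` only for `v` UNRAMIFIED in `E` (exponent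
`e_v f_v` with `e_v = 1`). Here the general case: for `E/F` Galois, `w ∣ v` any finite place and `ω` unramified
at `v`, `(ω ∘ N)(ϖ_w) = ω(ϖ_v)^{f(w|v)}` — because the idelic norm of the local idele `⟨ϖ_w⟩_w` is a local idele
`⟨c⟩_v` with `|c|_v = |ϖ_w|_w^{f_v} = |ϖ_v|_v^{f(w|v)}` (the tree's `exists_ideleRelNorm_localUnits_eq`,
`valued_eq_pow_inertiaDegIn_of_algebraMap_eq_norm_blockHom_localUnits`, Cassels–Fröhlich II §11, VII §1.2) and an
unramified `ω_v` depends only on the valuation (`IsUnramifiedAt.map_localUnits_eq_pow`). This is relation (1.1) of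
Arthur–Clozel for `GL₁` at all finite places (`hasSatakeParamAt_of_isWeakBaseChangeLiftAE_glOne_allFinite`), read for
the tree's `compRelNorm` (same definition as `HeckeCharacter.baseChange`). Requested by route
`BiquadraticEisensteinDescent` of `Summits/BirchSwinnertonDyer` (crux `EisensteinHeartFlatCMInertBadKPrime`,
hypothesis (L): the Euler factors of `ψ_W ∘ N_{L/K_CM}` above the primes of `K′` ramified over `ℚ`).

* `compRelNorm_valueAtUniformizer_eq_pow` — `(ω.compRelNorm E).valueAtUniformizer w = (ω.valueAtUniformizer v)^{f(w|v)}`.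
* `heckeValueExtZero`-free corollary `compRelNorm_valueAtUniformizer_eq_pow'` with `v := w.under (𝓞 F)`.

References: [CasselsFrohlichANT1967] Ch. II §11, Ch. VII §1.2; [ArthurClozelAMS120] Ch. 3 §1 (1.1); [TateThesis1967] §2.3.
-/

noncomputable section

open scoped NumberField
open NumberField IsDedekindDomain
open Literature.NumberTheory.Automorphic

namespace Literature.NumberTheory.GaloisRepresentations

namespace HeckeCharacter

variable {F E : Type} [Field F] [NumberField F] [Field E] [NumberField E] [Algebra F E] [IsGalois F E]

/-- **`(ω ∘ N_{E/F})(ϖ_w) = ω(ϖ_v)^{f(w|v)}` at every finite `w ∣ v`** (`E/F` Galois, `ω` unramified at `v`; no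
hypothesis on the ramification of `v` in `E`): `N_{E/F}⟨ϖ_w⟩ = ⟨c⟩_v` with `|c|_v = |ϖ_v|_v^{f(w|v)}`, and `ω_v` is
unramified. [cite: CasselsFrohlichANT1967, Ch. VII §1.2] [cite: ArthurClozelAMS120, Ch. 3 §1 (1.1)] -/
theorem compRelNorm_valueAtUniformizer_eq_pow (ω : HeckeCharacter F) {w : HeightOneSpectrum (𝓞 E)}
    {v : HeightOneSpectrum (𝓞 F)} (hw : w.under (𝓞 F) = v) (hω : ω.IsUnramifiedAt v) :
    (ω.compRelNorm E).valueAtUniformizer w = ω.valueAtUniformizer v ^ w.asIdeal.inertiaDeg (𝓞 F) := by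
  haveI : w.asIdeal.LiesOver v.asIdeal := ⟨(congrArg HeightOneSpectrum.asIdeal hw).symm⟩
  haveI : IsGaloisGroup (E ≃ₐ[F] E) (𝓞 F) (𝓞 E) := IsGaloisGroup.of_isFractionRing _ _ _ F E
  have hfIn : v.asIdeal.inertiaDegIn (𝓞 E) = w.asIdeal.inertiaDeg (𝓞 F) :=
    Ideal.inertiaDegIn_eq_inertiaDeg v.asIdeal w.asIdeal (E ≃ₐ[F] E)
  set ϖw := uniformizer E w with hϖw
  -- `N_{E/F} ⟨ϖ_w⟩ = ⟨c⟩_v` with `|c|_v = |ϖ_w|^{f} = |ϖ_v|^{f}`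
  obtain ⟨c, hc, hrel⟩ := Literature.NumberTheory.Automorphic.exists_ideleRelNorm_localUnits_eq (F := F) hw ϖw
  have hcval : Valued.v (c : v.adicCompletion F) =
      Valued.v ((uniformizer F v : (v.adicCompletion F)ˣ) : v.adicCompletion F) ^ w.asIdeal.inertiaDeg (𝓞 F) := by
    rw [valued_eq_pow_inertiaDegIn_of_algebraMap_eq_norm_blockHom_localUnits hw ϖw hc, hfIn, hϖw,
      valued_uniformizer, valued_uniformizer]
  rw [valueAtUniformizer, valueAtUniformizer, localComponent_apply, localComponent_apply, compRelNorm_apply,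
    hrel, hω.map_localUnits_eq_pow c (uniformizer F v) hcval, Units.val_pow_eq_pow_val]

/-- The same with `v := w ∩ 𝓞 F`. [cite: CasselsFrohlichANT1967, Ch. VII §1.2] -/
theorem compRelNorm_valueAtUniformizer_eq_pow' (ω : HeckeCharacter F) (w : HeightOneSpectrum (𝓞 E))
    (hω : ω.IsUnramifiedAt (w.under (𝓞 F))) :
    (ω.compRelNorm E).valueAtUniformizer w =
      ω.valueAtUniformizer (w.under (𝓞 F)) ^ w.asIdeal.inertiaDeg (𝓞 F) :=
  compRelNorm_valueAtUniformizer_eq_pow ω rfl hω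

end HeckeCharacter

end Literature.NumberTheory.GaloisRepresentations

end
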